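import Literature.NumberTheory.Sieve.SmoothParityTernary
import HarnessLib

/-!
# Small real inequalities for the flat form of the parity-class major arcs

Topic `Literature/NumberTheory/Sieve`, namespace `Literature.NumberTheory.Sieve.SmoothArcs`; a PROVED tool file for
`SmoothParityMajorArcsFlat` ([Harper2016, §5]): elementary bounds used to flatten the explicit error `ERR` of
`parity_major_arcs` — the three-factor difference bound `prod3_sub_prod3_le`, `|log t| ≤ log 2e` on `[1/(2e), 1]`,
`R²(1+4R²)³ ≤ 125R⁸`, the tail factor `3(d₁d₂)^α e^{…}(R+1)^{−(3α−13/5)/2} ≤ 24D²(R+1)^{−1/6}` for `α ≥ 1 − 10⁻⁴`, and the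
lattice and off-arc factors `LAT ≤ e₃(28 + 16 log 2e_B)`, `OFF ≤ e₃(e_B/(3R) + 8D(1 + 2e_B(1 + log 2x))/x)` for
`x ≤ N₀ ≤ 2x`, `e_i ≤ e_B`, `d₁ ≤ D`, `d₁X₁ ≤ x`.  Pure real arithmetic; no number theory.

## References

* A. J. Harper, Compositio Math. 152 (2016), §5 [Harper2016].
-/

noncomputable section

open Finset Real

namespace Literature.NumberTheory.Sieve

namespace SmoothArcs

/-! ### Small real inequalities -/

/-- Three-factor difference bound: for `0 ≤ a_i ≤ A`, `0 ≤ t_i ≤ T`,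
`(a₁+t₁)(a₂+t₂)(a₃+t₃) − a₁a₂a₃ ≤ 3(A+T)²T`. [folklore] -/
theorem prod3_sub_prod3_le {a₁ a₂ a₃ t₁ t₂ t₃ A T : ℝ} (ha₁ : 0 ≤ a₁) (ha₂ : 0 ≤ a₂) (ha₃ : 0 ≤ a₃)
    (hA₁ : a₁ ≤ A) (hA₂ : a₂ ≤ A) (hA₃ : a₃ ≤ A) (ht₁ : 0 ≤ t₁) (ht₂ : 0 ≤ t₂) (ht₃ : 0 ≤ t₃)
    (hT₁ : t₁ ≤ T) (hT₂ : t₂ ≤ T) (hT₃ : t₃ ≤ T) :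
    (a₁ + t₁) * (a₂ + t₂) * (a₃ + t₃) - a₁ * a₂ * a₃ ≤ 3 * (A + T) ^ 2 * T := by
  have hA : 0 ≤ A := ha₁.trans hA₁
  have hT : 0 ≤ T := ht₁.trans hT₁
  have h1 : t₁ * ((a₂ + t₂) * (a₃ + t₃)) ≤ T * ((A + T) * (A + T)) :=
    mul_le_mul hT₁ (mul_le_mul (by linarith) (by linarith) (by positivity) (by linarith)) (by positivity) hT
  have h2 : a₁ * t₂ * (a₃ + t₃) ≤ (A + T) * T * (A + T) :=
    mul_le_mul (mul_le_mul (by linarith) hT₂ ht₂ (by linarith)) (by linarith) (by positivity) (by positivity)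
  have h3 : a₁ * a₂ * t₃ ≤ (A + T) * (A + T) * T :=
    mul_le_mul (mul_le_mul (by linarith) (by linarith) ha₂ (by linarith)) hT₃ ht₃ (by positivity)
  nlinarith [h1, h2, h3]

/-- `|log t| ≤ log 2e` for `1/(2e) ≤ t ≤ 1`, `e ≥ 1`. [folklore] -/
theorem abs_log_le_log_two_mul {t e : ℝ} (he : 1 ≤ e) (ht1 : t ≤ 1) (ht0 : 1 / (2 * e) ≤ t) :
    |Real.log t| ≤ Real.log (2 * e) := by
  have h2e : 0 < 2 * e := by linarith
  have ht : 0 < t := lt_of_lt_of_le (by positivity) ht0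
  rw [abs_of_nonpos (Real.log_nonpos ht.le ht1), ← Real.log_inv]
  refine Real.log_le_log (inv_pos.2 ht) ?_
  rw [inv_le_comm₀ ht h2e, ← one_div]
  exact ht0

/-- `(1 + 4R²)³ R² ≤ 125 R⁸` for `R ≥ 1`. [folklore] -/
theorem sq_mul_one_add_four_sq_cube_le {R : ℝ} (hR : 1 ≤ R) : R ^ 2 * (1 + 4 * R ^ 2) ^ 3 ≤ 125 * R ^ 8 := by
  have h1 : 1 + 4 * R ^ 2 ≤ 5 * R ^ 2 := by nlinarith
  have h2 : (1 + 4 * R ^ 2) ^ 3 ≤ (5 * R ^ 2) ^ 3 := pow_le_pow_left₀ (by positivity) h1 3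
  nlinarith [h2, pow_nonneg (by linarith : (0 : ℝ) ≤ R) 2]

/-- The tail factor of `parity_major_arcs` for `1 − 10⁻⁴ ≤ α ≤ 1`, `1 ≤ d₁d₂ ≤ D²`:
`3(d₁d₂)^α exp(2420(1−α)/((3α−13/5)/2)) (R+1)^{−(3α−13/5)/2} ≤ 24 D² (R+1)^{−1/6}`. [folklore] -/
theorem tail_factor_le {α D : ℝ} (hα4 : 1 - 1 / 10000 ≤ α) (hα1 : α ≤ 1) {d₁ d₂ : ℕ} (hd₁ : 1 ≤ d₁) (hd₂ : 1 ≤ d₂)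
    (hd₁D : (d₁ : ℝ) ≤ D) (hd₂D : (d₂ : ℝ) ≤ D) (R : ℕ) :
    3 * ((d₁ * d₂ : ℕ) : ℝ) ^ α * Real.exp (2420 * (1 - α) / (3 * α - 13 / 5 - (3 * α - 13 / 5) / 2)) *
        ((R + 1 : ℕ) : ℝ) ^ (-((3 * α - 13 / 5) / 2)) ≤ 24 * D ^ 2 * ((R : ℝ) + 1) ^ (-(1 / 6 : ℝ)) := by
  have hdd1 : (1 : ℝ) ≤ ((d₁ * d₂ : ℕ) : ℝ) := by exact_mod_cast Nat.mul_le_mul hd₁ hd₂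
  have hD1 : (1 : ℝ) ≤ D := le_trans (by exact_mod_cast hd₁) hd₁D
  -- `(d₁d₂)^α ≤ d₁d₂ ≤ D²`
  have h1 : ((d₁ * d₂ : ℕ) : ℝ) ^ α ≤ D ^ 2 := by
    calc ((d₁ * d₂ : ℕ) : ℝ) ^ α ≤ ((d₁ * d₂ : ℕ) : ℝ) ^ (1 : ℝ) := Real.rpow_le_rpow_of_exponent_le hdd1 hα1
      _ = (d₁ : ℝ) * d₂ := by rw [Real.rpow_one]; push_cast; ring
      _ ≤ D * D := mul_le_mul hd₁D hd₂D (Nat.cast_nonneg _) (by linarith)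
      _ = D ^ 2 := by ring
  -- the exponential factor is `≤ e² < 8`
  have hden : 0 < 3 * α - 13 / 5 - (3 * α - 13 / 5) / 2 := by linarith
  have h2 : Real.exp (2420 * (1 - α) / (3 * α - 13 / 5 - (3 * α - 13 / 5) / 2)) ≤ 8 := by
    have hle : 2420 * (1 - α) / (3 * α - 13 / 5 - (3 * α - 13 / 5) / 2) ≤ 2 := by
      rw [div_le_iff₀ hden]; linarith
    calc _ ≤ Real.exp 2 := Real.exp_le_exp.2 hle
      _ = Real.exp 1 ^ 2 := by rw [← Real.exp_nat_mul]; norm_num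
      _ ≤ 8 := by nlinarith [Real.exp_one_lt_d9, Real.exp_pos 1]
  -- the power of `R + 1`
  have h3 : ((R + 1 : ℕ) : ℝ) ^ (-((3 * α - 13 / 5) / 2)) ≤ ((R : ℝ) + 1) ^ (-(1 / 6 : ℝ)) := by
    push_cast
    exact Real.rpow_le_rpow_of_exponent_le (by linarith [(Nat.cast_nonneg R : (0 : ℝ) ≤ R)]) (by linarith)
  have h3' : 0 ≤ ((R + 1 : ℕ) : ℝ) ^ (-((3 * α - 13 / 5) / 2)) := Real.rpow_nonneg (Nat.cast_nonneg _) _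
  calc _ ≤ 3 * D ^ 2 * 8 * ((R : ℝ) + 1) ^ (-(1 / 6 : ℝ)) :=
        mul_le_mul (mul_le_mul (mul_le_mul_of_nonneg_left h1 (by norm_num)) h2 (Real.exp_pos _).le
          (by positivity)) h3 h3' (by positivity)
    _ = _ := by ring

/-- **The lattice factor of `parity_major_arcs`**: for `x ≤ N₀ ≤ 2x`, `1 ≤ e₁, e₃ ≤ e_B`, `1 ≤ d₁`, `d₁(x/e₁) ≤ x`,
`4(1 + (N₀/X₃)(3 + |log(X₃/N₀)| + |log(d₁X₁/N₀)|)) ≤ e₃(28 + 16 log 2e_B)` (`X_i = x/e_i`). [folklore] -/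
theorem lat_factor_le {x eB N₀ : ℝ} {e₁ e₃ d₁ : ℕ} (hx0 : 0 < x) (he₁ : 1 ≤ e₁) (he₃ : 1 ≤ e₃)
    (heB₁ : (e₁ : ℝ) ≤ eB) (heB₃ : (e₃ : ℝ) ≤ eB) (hd₁1 : 1 ≤ d₁) (hd₁ : (d₁ : ℝ) * (x / e₁) ≤ x)
    (hxN : x ≤ N₀) (hN2 : N₀ ≤ 2 * x) :
    4 * (1 + N₀ / (x / e₃) * (3 + |Real.log (x / e₃ / N₀)| + |Real.log ((d₁ : ℝ) * (x / e₁) / N₀)|)) ≤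
      (e₃ : ℝ) * (28 + 16 * Real.log (2 * eB)) := by
  obtain ⟨he₁0, he₃0⟩ : (0 : ℝ) < e₁ ∧ (0 : ℝ) < e₃ := ⟨by exact_mod_cast he₁, by exact_mod_cast he₃⟩
  obtain ⟨he₁1, he₃1⟩ : (1 : ℝ) ≤ e₁ ∧ (1 : ℝ) ≤ e₃ := ⟨by exact_mod_cast he₁, by exact_mod_cast he₃⟩
  have heB1 : 1 ≤ eB := he₁1.trans heB₁
  have hN0 : 0 < N₀ := by linarith
  have hX₃x : x / e₃ ≤ x := div_le_self hx0.le he₃1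
  have hlog2eB : 0 ≤ Real.log (2 * eB) := Real.log_nonneg (by linarith)
  have hNX : N₀ / (x / e₃) ≤ 2 * e₃ := by
    rw [div_div_eq_mul_div, div_le_iff₀ hx0]
    calc N₀ * e₃ ≤ 2 * x * e₃ := mul_le_mul_of_nonneg_right hN2 he₃0.le
      _ = 2 * e₃ * x := by ring
  have hl1 : |Real.log (x / e₃ / N₀)| ≤ Real.log (2 * eB) := by
    refine abs_log_le_log_two_mul heB1 ((div_le_one hN0).2 (hX₃x.trans hxN)) ?_
    rw [div_div, div_le_div_iff₀ (by positivity) (by positivity), one_mul]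
    calc (e₃ : ℝ) * N₀ ≤ eB * (2 * x) := mul_le_mul heB₃ hN2 hN0.le (by linarith)
      _ = x * (2 * eB) := by ring
  have hl2 : |Real.log ((d₁ : ℝ) * (x / e₁) / N₀)| ≤ Real.log (2 * eB) := by
    have hd₁r : (1 : ℝ) ≤ d₁ := by exact_mod_cast hd₁1
    refine abs_log_le_log_two_mul heB1 ((div_le_one hN0).2 (hd₁.trans hxN)) ?_
    rw [div_le_div_iff₀ (by positivity) hN0, one_mul]
    calc N₀ ≤ 2 * x := hN2
      _ ≤ 2 * (d₁ * x) := mul_le_mul_of_nonneg_left (le_mul_of_one_le_left hx0.le hd₁r) (by norm_num)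
      _ ≤ 2 * (d₁ * x) * (eB / e₁) := le_mul_of_one_le_right (by positivity) ((one_le_div he₁0).2 heB₁)
      _ = d₁ * (x / e₁) * (2 * eB) := by ring
  have h3 : 3 + |Real.log (x / e₃ / N₀)| + |Real.log ((d₁ : ℝ) * (x / e₁) / N₀)| ≤ 3 + 2 * Real.log (2 * eB) := by
    linarith
  calc 4 * (1 + N₀ / (x / e₃) * (3 + |Real.log (x / e₃ / N₀)| + |Real.log ((d₁ : ℝ) * (x / e₁) / N₀)|))
      ≤ 4 * (1 + 2 * e₃ * (3 + 2 * Real.log (2 * eB))) := by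
        gcongr 4 * (1 + ?_)
        exact mul_le_mul hNX h3 (by positivity) (by positivity)
    _ ≤ 4 * ((e₃ : ℝ) + 2 * e₃ * (3 + 2 * Real.log (2 * eB))) := by gcongr
    _ = (e₃ : ℝ) * (28 + 16 * Real.log (2 * eB)) := by ring

/-- **The off-arc factor of `parity_major_arcs`**: for `x ≤ N₀ ≤ 2x`, `1 ≤ e₁, e₃ ≤ e_B`, `1 ≤ d₁ ≤ D`, `R ≥ 1`,
`16N₀/(X₃·d₁X₁·(96R/x)) + (2d₁/X₃)·4(1 + (N₀/X₁)(1 + log N₀)) ≤ e₃(e_B/(3R) + 8D(1 + 2e_B(1 + log 2x))/x)`. [folklore] -/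
theorem off_factor_le {x eB N₀ D R : ℝ} {e₁ e₃ d₁ : ℕ} (hx1 : 1 ≤ x) (he₁ : 1 ≤ e₁) (he₃ : 1 ≤ e₃)
    (heB₁ : (e₁ : ℝ) ≤ eB) (hd₁1 : 1 ≤ d₁) (hd₁D : (d₁ : ℝ) ≤ D) (hR : 1 ≤ R)
    (hxN : x ≤ N₀) (hN2 : N₀ ≤ 2 * x) :
    16 * N₀ / (x / e₃ * ((d₁ : ℝ) * (x / e₁)) * (96 * R / x)) + 2 * d₁ / (x / e₃) * (4 * (1 + N₀ / (x / e₁) * (1 + Real.log N₀))) ≤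
      (e₃ : ℝ) * (eB / (3 * R) + 8 * D * (1 + 2 * eB * (1 + Real.log (2 * x))) / x) := by
  have hx0 : 0 < x := by linarith
  obtain ⟨he₁0, he₃0⟩ : (0 : ℝ) < e₁ ∧ (0 : ℝ) < e₃ := ⟨by exact_mod_cast he₁, by exact_mod_cast he₃⟩
  have he₁1 : (1 : ℝ) ≤ e₁ := by exact_mod_cast he₁
  have heB1 : 1 ≤ eB := he₁1.trans heB₁
  have hN0 : 0 < N₀ := by linarith
  have hN1 : 1 ≤ N₀ := hx1.trans hxN
  have hd₁r : (1 : ℝ) ≤ d₁ := by exact_mod_cast hd₁1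
  have hD0 : 0 ≤ D := le_trans (by positivity) hd₁D
  have hlog2x : 0 ≤ Real.log (2 * x) := Real.log_nonneg (by linarith)
  have h1 : 16 * N₀ / (x / e₃ * ((d₁ : ℝ) * (x / e₁)) * (96 * R / x)) ≤ (e₃ : ℝ) * (eB / (3 * R)) := by
    rw [div_le_iff₀ (by positivity)]
    have hkey : (e₃ : ℝ) * (eB / (3 * R)) * (x / e₃ * (d₁ * (x / e₁)) * (96 * R / x)) = 32 * x * (d₁ * (eB / e₁)) := by
      field_simp
      ring
    rw [hkey]
    have h1' : (1 : ℝ) ≤ d₁ * (eB / e₁) := one_le_mul_of_one_le_of_one_le hd₁r ((one_le_div he₁0).2 heB₁)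
    calc (16 : ℝ) * N₀ ≤ 16 * (2 * x) := mul_le_mul_of_nonneg_left hN2 (by norm_num)
      _ = 32 * x * 1 := by ring
      _ ≤ 32 * x * (d₁ * (eB / e₁)) := mul_le_mul_of_nonneg_left h1' (by positivity)
  have h2 : 2 * d₁ / (x / e₃) * (4 * (1 + N₀ / (x / e₁) * (1 + Real.log N₀))) ≤
      (e₃ : ℝ) * (8 * D * (1 + 2 * eB * (1 + Real.log (2 * x))) / x) := by
    have hlogN : 0 ≤ Real.log N₀ := Real.log_nonneg hN1
    have hlogN' : Real.log N₀ ≤ Real.log (2 * x) := Real.log_le_log hN0 hN2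
    have hNX₁ : N₀ / (x / e₁) ≤ 2 * eB := by
      rw [div_div_eq_mul_div, div_le_iff₀ hx0]
      calc N₀ * e₁ ≤ 2 * x * eB := mul_le_mul hN2 heB₁ he₁0.le (by positivity)
        _ = 2 * eB * x := by ring
    calc 2 * d₁ / (x / e₃) * (4 * (1 + N₀ / (x / e₁) * (1 + Real.log N₀)))
        ≤ 2 * D / (x / e₃) * (4 * (1 + 2 * eB * (1 + Real.log (2 * x)))) := by gcongr
      _ = (e₃ : ℝ) * (8 * D * (1 + 2 * eB * (1 + Real.log (2 * x))) / x) := by field_simp; ring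
  calc _ ≤ (e₃ : ℝ) * (eB / (3 * R)) + (e₃ : ℝ) * (8 * D * (1 + 2 * eB * (1 + Real.log (2 * x))) / x) :=
        add_le_add h1 h2
    _ = _ := by ring

end SmoothArcs

end Literature.NumberTheory.Sieve

end
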